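import Literature.AnabelianGeometry.AbsoluteAnabelian.AbsTopII.EllipticCuspidalizationComparisonPrime

/-!
# [AbsTopI] Def 4.2 (i)(c)/(iii)(c) for the datum's open immersions: the kernel law (`OpenImmersionKernelLaw`)

S. Mochizuki, *Topics in Absolute Anabelian Geometry I: Generalities* [AbsTopI] (bib
`MochizukiAbsTopI2012`; locators = PDF pages of the kurims manuscript `paper:url-11ac98ba15fc`), §4,
Def 4.2 (i)(c) p. 48, Def 4.2 (iii)(c) p. 50, Remark 4.2.1 p. 51; consumed in S. Mochizuki, *Topics in
Absolute Anabelian Geometry II* [AbsTopII] (`MochizukiAbsTopII2013`) §3, Cor 3.3 / 3.7 / 3.8 (the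
"natural surjection `Π_{U_X} ↠ Π`" of an open subscheme).  Printed text:

> Def 4.2 (i)(c) p. 48: "Type •: … the elementary operation `X_j ⇝ X_{j+1}` consists of an open
> immersion `φ : X_j ↪ X_{j+1}` [so `k_j = k_{j+1}`] — i.e., a “de-cuspidalization” — such that the image
> of `φ` is the complement of a single `k_{j+1}`-valued point of `X_{j+1}` whose decomposition group in
> `Δ_j` is contained in some normal open torsion-free subgroup of `Δ_j`.  Thus, `φ` determines a
> surjection of profinite groups `Π_j ↠ Π_{j+1}`."
> Def 4.2 (iii)(c) p. 50: "Type •: … a surjection of profinite groups `φ : Π_j ↠ Π_{j+1}`, such that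
> `Ker(φ)` is topologically normally generated by a cuspidal decomposition group `C` in `Δ_j` such that
> `C` is contained in some normal open torsion-free subgroup of `Δ_j`."
> Remark 4.2.1 p. 51: "Thus, it follows immediately from the definitions that if … `X_0 ⇝ X_1 ⇝ … ⇝ X_n`
> is an `X̃/X`-chain, then the resulting profinite groups `Π_j` determine a `Π`-chain … with the same
> associated type-chain."

Statements file (ONE `Prop`-valued mixin predicate, no data), abc-iut-L4-t6 lineage ([AbsTopII] §3
typer of record; `BelyiDatumModel` p439386), cell row «OPEN-IMM-KERNEL-LAW» (abc-iut-L4-lead RULING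
#8h (3)).  CONTEXT: abc-iut-L4-t4's datum model `EllipticDatumModel` (p434497) flags the open immersions
`ι : U → X` of the datum and carries ONE law for them, surjectivity of `[π₁(ι)] : Π_U ↠ Π_X`
(`isOpenImmersion_surjective`).  abc-iut-f-064's datum-level separation certificate
(`AbsTopII/BelyiCuspidalizationDatumSchemaScope.lean`, p441764 / p442459) LOCATED the residual freedom
of the datum typings of Cor 3.7″ / 3.8 in the absence of any law on the KERNEL of `[π₁(ι)]` (a junk
"open immersion" `pr₁ : (G × G) × G ↠ G × G` with no cusp recorded), and showed that at cusp-free data a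
kernel law of the printed (3_Π)/(c) shape decides both facts.  Print asserts that law for a single-point
de-cuspidalization (Def 4.2 (i)(c) with (iii)(c), Remark 4.2.1: "immediately from the definitions");
an open immersion of curves with finite complement is, after the points are made rational, an iterate
of such.  The predicate below types the iterate as a MIXIN on a datum model — a hypothesis
`(hK : M.OpenImmersionKernelLaw)` consumers bind BY NAME; it applies to `BelyiDatumModel` through
`toEllipticDatumModel`; NOTHING of p434497 / p439386 is edited (no `V2` structure: the flag's owner
structure is being extended concurrently, row «COR34-DATUM»).
Spelling: the tree's `ChainGroup.KerTopNormallyGeneratedBy` (`AbsTopIChains.lean`): kernel `=` the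
closure of the normal closure of the generating set; the generators are the cuspidal decomposition
groups IN `Δ_U` — `CuspidalData.Icusp = Dcusp ⊓ Δ` — of a SUBSET `S` of the cusps of `U`.
-- TODO(general form): print's `S` is "the cusps of `U` lying over `X ∖ ι(U)`"; the datum carries no
map of cusps along `ι`, so `S` is existential here; (c)'s guard "contained in some normal open
torsion-free subgroup of `Δ_j`" (scheme-likeness for orbicurves) is not part of the kernel statement
and stays where it is typed (`ChainGroup.IsDeCuspVia`).
DECLINED in the same ruling (recorded, not typed): "iso-invariance of the flags" — `RelativeAnabelianDatum`
has `Hom` without composition, so "`U ↪ X₁ ⥲ X₂` is an open of `X₂`" has no term to flag; that is a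
closure property of the datum, not a §3 law.
HONEST FRAMING: a LAW of a MODEL INTERFACE the tree does not instantiate (étale `π₁`, FOUNDATIONS row
12), true at genuine data by the structure of the tame fundamental group (SGA1 XIII) as print uses it;
typed ≠ proved; nothing here bears on [IUTchIII] Cor 3.12.
-/

open CategoryTheory Topology
open scoped Pointwise

universe u

namespace Literature.AnabelianGeometry.AbsoluteAnabelian.AbsTopII

open FundamentalExtension
open AbsTopI (ConstructionDataClass)
open AugmentedProfiniteGrp

variable {𝒟 : ConstructionDataClass.{u}}

namespace EllipticDatumModel

/-- **The kernel law for the datum's open immersions** ([AbsTopI] Def 4.2 (i)(c) + (iii)(c), Remark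
4.2.1, iterated): for every open immersion `ι : U → X` of the datum and every representative `ψ` of
`[π₁(ι)] : Π_U ↠ Π_X`, "`Ker(ψ)` is topologically normally generated by cuspidal decomposition groups in
`Δ_U`" — `Ker ψ` is the closure of the normal closure of `⋃_{c ∈ S} I_c` for some set `S` of cusps of `U`
(`I_c = D_c ∩ Δ_U` the model's cuspidal decomposition groups in `Δ_U`; at genuine data `S` = the cusps of
`U` over the finitely many points of `X ∖ ι(U)`, and `S = ∅`, `ψ` injective, when `ι` is an
isomorphism onto `X`).  A `Prop`-valued MIXIN on abc-iut-L4-t4's `EllipticDatumModel` (whose own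
open-immersion law is surjectivity only), bound by name by consumers; applies to `BelyiDatumModel` via
`toEllipticDatumModel`.  (One field; no `mk_iff` — use `⟨…⟩` / `.ker_eq`.)
[cite: MochizukiAbsTopI2012, Def 4.2 (iii)(c) p.50] -/
structure OpenImmersionKernelLaw (M : EllipticDatumModel 𝒟) : Prop where
  /-- `Ker [π₁(ι)]` is topologically normally generated by the cuspidal decomposition groups in `Δ_U`
  of some of the cusps of `U` -/
  ker_eq : ∀ {b : 𝒟.Base} {U X : (𝒟.datum b).Obj} (ι : (𝒟.datum b).Hom U X), M.IsOpenImmersion ι →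
    ∀ ψ : HomOver ((𝒟.datum b).grp U) ((𝒟.datum b).grp X),
      OuterHom.mk ψ = (𝒟.datum b).outerHom ι →
        ∃ S : Set (M.cusps b U).Cusp,
          (ψ.toHom.toMonoidHom.ker : Subgroup ((𝒟.datum b).ext U).arith) =
            (Subgroup.normalClosure (⋃ c ∈ S,
              ((M.cusps b U).Icusp c : Set ((𝒟.datum b).ext U).arith))).topologicalClosure

end EllipticDatumModel

end Literature.AnabelianGeometry.AbsoluteAnabelian.AbsTopII
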